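import Summits.QuantumFields.QCD.Theorems.HeatSlicedQuarksQuarkLoopCoefficientSecondOrderCoefficientAuxB

/-!
# Quark-loop coefficient, stub `secondOrderCoefficient`, part C: single-momentum collapse

Helper file of the line `Sketch` of crux stmt-QuantumFields-16786 (stub `stub_secondOrderCoefficient`:
`e2 t → 1/(12π²)` at rate `C/t`).  Given the semigroup law, the IBP identity
`t Σ_z z_ν ĥ(z) k_t(w−z) + w_ν k_t(w) = 0` and evenness of the free kernel `k_t = freeKer t` (conjuncts of the
line's `FreeHeatCalculus`, hypotheses here), the `w`-sums of `k_a(w) P(w) k_b(w − u)` against polynomial weights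
`P ∈ {1, w_ν, v∧w, w_μ w_ν, (v∧w)²}` collapse to finite combinations of values of `k_{a+b}`
("single-momentum collapse"): e.g. `Σ_w k_a(w) w_ν k_b(w−u) = (a/(a+b)) u_ν k_{a+b}(u)` and
`Σ_w k_a(w) (v∧w)² k_b(w−u) = α²(v∧u)² k_{a+b}(u) − bα Σ_z ĥ(z)(v∧z)² k_{a+b}(u+z)`, `α = a/(a+b)`.
Mathlib + the Defs file + parts A, B.
-/

noncomputable section

namespace Summit.QuantumFields.QCD.Cruxes.QuarkLoopCoefficient.Sketch.SecondOrderCoefficient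

open Literature.MathematicalPhysics.QuantumLattice Literature.MathematicalPhysics.QuantumFieldTheory
open Literature.Probability.LatticeModels (Site)
open Summit.QuantumFields.QCD.Theorems.QuarkLoopCoefficient
open Summit.QuantumFields.QCD.Cruxes.QuarkLoopCoefficient.Sketch.HeatSeries
open scoped Matrix ComplexConjugate

attribute [local irreducible] nbr nbr2

/-! ## Single-momentum collapse: the `w`-sums against `k_{t−s}(w)` -/

section Collapse

variable
  (hsemi : ∀ s r : ℝ, 0 ≤ s → 0 ≤ r → ∀ w : Site 4,
    HasSum (fun y : Site 4 => freeKer s y * freeKer r (w - y)) (freeKer (s + r) w))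
  (hibp : ∀ t : ℝ, 0 ≤ t → ∀ (w : Site 4) (ν : Fin 4),
    t * (∑ z ∈ nbr2 0, ((z ν : ℤ) : ℝ) * hhat z * freeKer t (w - z)) + ((w ν : ℤ) : ℝ) * freeKer t w = 0)
  (heven : ∀ (t : ℝ) (w : Site 4), freeKer t (-w) = freeKer t w)
omit hsemi heven in
/-- Transport of a `HasSum` statement along equal functions and equal values. -/
theorem hasSum_of_eq {f g : Site 4 → ℝ} {a b : ℝ} (h : HasSum f a) (hfg : ∀ w, f w = g w) (hab : a = b) :
    HasSum g b := by
  subst hab; exact (funext hfg : f = g) ▸ h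

include hsemi heven

/-- Semigroup law in the form used below: `Σ_w k_a(w) k_b(w − u) = k_{a+b}(u)`. -/
theorem hasSum_ker_mul_ker {a b : ℝ} (ha : 0 ≤ a) (hb : 0 ≤ b) (u : Site 4) :
    HasSum (fun w : Site 4 => freeKer a w * freeKer b (w - u)) (freeKer (a + b) u) := by
  have h := hsemi a b ha hb u
  convert h using 2 with w
  rw [← heven b (w - u), neg_sub]

omit hsemi in
include hibp in
/-- The IBP identity with the shift on the other side: `t Σ_z z_ν ĥ(z) k_t(w + z) = w_ν k_t(w)`. -/
theorem ibp_add {t : ℝ} (ht : 0 ≤ t) (w : Site 4) (ν : Fin 4) :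
    t * ∑ z ∈ nbr2 0, ((z ν : ℤ) : ℝ) * hhat z * freeKer t (w + z) = ((w ν : ℤ) : ℝ) * freeKer t w := by
  have h := hibp t ht (-w) ν
  simp only [Pi.neg_apply, Int.cast_neg, neg_mul, heven, ← neg_add', add_neg_eq_zero] at h
  exact h

include hibp in
/-- First-order collapse: `Σ_w k_a(w) w_ν k_b(w − u) = (a/(a+b)) u_ν k_{a+b}(u)` (`a + b > 0`). -/
theorem hasSum_ker_coord_ker {a b : ℝ} (ha : 0 ≤ a) (hb : 0 ≤ b) (hab : 0 < a + b) (u : Site 4) (ν : Fin 4) :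
    HasSum (fun w : Site 4 => freeKer a w * (((w ν : ℤ) : ℝ) * freeKer b (w - u)))
      (a / (a + b) * ((u ν : ℤ) : ℝ) * freeKer (a + b) u) := by
  have key : ∀ w : Site 4, freeKer a w * (((w ν : ℤ) : ℝ) * freeKer b (w - u)) =
      ((u ν : ℤ) : ℝ) * (freeKer a w * freeKer b (w - u)) -
        ∑ z ∈ nbr2 0, (b * (((z ν : ℤ) : ℝ) * hhat z)) * (freeKer a w * freeKer b (w - (u + z))) := by
    intro w
    have h := hibp b hb (w - u) ν
    have h' : ∑ z ∈ nbr2 0, (b * (((z ν : ℤ) : ℝ) * hhat z)) * (freeKer a w * freeKer b (w - (u + z))) =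
        freeKer a w * (b * ∑ z ∈ nbr2 0, ((z ν : ℤ) : ℝ) * hhat z * freeKer b (w - u - z)) := by
      rw [Finset.mul_sum, Finset.mul_sum]
      refine Finset.sum_congr rfl fun z _ => ?_
      rw [sub_sub]; ring
    rw [h']
    simp only [Pi.sub_apply, Int.cast_sub] at h
    linear_combination (freeKer a w) * h
  simp only [key]
  have h1 := (hasSum_ker_mul_ker hsemi heven ha hb u).mul_left ((u ν : ℤ) : ℝ)
  have h2 : HasSum (fun w : Site 4 => ∑ z ∈ nbr2 0, (b * (((z ν : ℤ) : ℝ) * hhat z)) *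
      (freeKer a w * freeKer b (w - (u + z))))
      (∑ z ∈ nbr2 0, (b * (((z ν : ℤ) : ℝ) * hhat z)) * freeKer (a + b) (u + z)) :=
    hasSum_sum fun z _ => (hasSum_ker_mul_ker hsemi heven ha hb (u + z)).mul_left _
  refine hasSum_of_eq (h1.sub h2) (fun w => rfl) ?_
  have hi := ibp_add hibp heven hab.le u ν
  have hS : ∑ z ∈ nbr2 0, (b * (((z ν : ℤ) : ℝ) * hhat z)) * freeKer (a + b) (u + z) =
      b * ∑ z ∈ nbr2 0, ((z ν : ℤ) : ℝ) * hhat z * freeKer (a + b) (u + z) := by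
    rw [Finset.mul_sum]
    refine Finset.sum_congr rfl fun z _ => ?_
    ring
  rw [hS]
  field_simp
  linear_combination (-b) * hi

include hibp in
/-- First-order collapse with the wedge weight: `Σ_w k_a(w) (v∧w) k_b(w − u) = (a/(a+b)) (v∧u) k_{a+b}(u)`. -/
theorem hasSum_ker_wedge_ker {a b : ℝ} (ha : 0 ≤ a) (hb : 0 ≤ b) (hab : 0 < a + b) (v u : Site 4) :
    HasSum (fun w : Site 4 => freeKer a w * (((wedge v w : ℤ) : ℝ) * freeKer b (w - u)))
      (a / (a + b) * ((wedge v u : ℤ) : ℝ) * freeKer (a + b) u) := by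
  have h0 := (hasSum_ker_coord_ker hsemi hibp heven ha hb hab u 0).mul_left ((v 1 : ℤ) : ℝ)
  have h1 := (hasSum_ker_coord_ker hsemi hibp heven ha hb hab u 1).mul_left ((v 0 : ℤ) : ℝ)
  refine hasSum_of_eq (h1.sub h0) (fun w => ?_) ?_
  · simp only [wedge]; push_cast; ring
  · simp only [wedge]; push_cast; ring

include hibp in
/-- Second-order collapse: `Σ_w k_a(w) w_μ w_ν k_b(w − u) = α² u_μ u_ν k_{a+b}(u) − bα Σ_z z_μ z_ν ĥ(z) k_{a+b}(u+z)`
with `α = a/(a+b)`. -/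
theorem hasSum_ker_coord_coord_ker {a b : ℝ} (ha : 0 ≤ a) (hb : 0 ≤ b) (hab : 0 < a + b) (u : Site 4)
    (μ ν : Fin 4) :
    HasSum (fun w : Site 4 => freeKer a w * (((w μ : ℤ) : ℝ) * ((w ν : ℤ) : ℝ) * freeKer b (w - u)))
      ((a / (a + b)) ^ 2 * ((u μ : ℤ) : ℝ) * ((u ν : ℤ) : ℝ) * freeKer (a + b) u -
        b * (a / (a + b)) * ∑ z ∈ nbr2 0, ((z μ : ℤ) : ℝ) * ((z ν : ℤ) : ℝ) * hhat z * freeKer (a + b) (u + z)) := by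
  have key : ∀ w : Site 4, freeKer a w * (((w μ : ℤ) : ℝ) * ((w ν : ℤ) : ℝ) * freeKer b (w - u)) =
      ((u ν : ℤ) : ℝ) * (freeKer a w * (((w μ : ℤ) : ℝ) * freeKer b (w - u))) -
        ∑ z ∈ nbr2 0, (b * (((z ν : ℤ) : ℝ) * hhat z)) *
          (freeKer a w * (((w μ : ℤ) : ℝ) * freeKer b (w - (u + z)))) := by
    intro w
    have h := hibp b hb (w - u) ν
    have h' : ∑ z ∈ nbr2 0, (b * (((z ν : ℤ) : ℝ) * hhat z)) *
        (freeKer a w * (((w μ : ℤ) : ℝ) * freeKer b (w - (u + z)))) =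
        freeKer a w * ((w μ : ℤ) : ℝ) * (b * ∑ z ∈ nbr2 0, ((z ν : ℤ) : ℝ) * hhat z * freeKer b (w - u - z)) := by
      rw [Finset.mul_sum, Finset.mul_sum]
      refine Finset.sum_congr rfl fun z _ => ?_
      rw [sub_sub]; ring
    rw [h']
    simp only [Pi.sub_apply, Int.cast_sub] at h
    linear_combination (freeKer a w * ((w μ : ℤ) : ℝ)) * h
  simp only [key]
  have h1 := (hasSum_ker_coord_ker hsemi hibp heven ha hb hab u μ).mul_left ((u ν : ℤ) : ℝ)
  have h2 : HasSum (fun w : Site 4 => ∑ z ∈ nbr2 0, (b * (((z ν : ℤ) : ℝ) * hhat z)) *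
      (freeKer a w * (((w μ : ℤ) : ℝ) * freeKer b (w - (u + z)))))
      (∑ z ∈ nbr2 0, (b * (((z ν : ℤ) : ℝ) * hhat z)) * (a / (a + b) * (((u + z) μ : ℤ) : ℝ) * freeKer (a + b) (u + z))) :=
    hasSum_sum fun z _ => (hasSum_ker_coord_ker hsemi hibp heven ha hb hab (u + z) μ).mul_left _
  refine hasSum_of_eq (h1.sub h2) (fun w => rfl) ?_
  have hi := ibp_add hibp heven hab.le u ν
  have hS : ∑ z ∈ nbr2 0, (b * (((z ν : ℤ) : ℝ) * hhat z)) *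
      (a / (a + b) * (((u + z) μ : ℤ) : ℝ) * freeKer (a + b) (u + z)) =
      b * (a / (a + b)) * (((u μ : ℤ) : ℝ) * ∑ z ∈ nbr2 0, ((z ν : ℤ) : ℝ) * hhat z * freeKer (a + b) (u + z)) +
      b * (a / (a + b)) * ∑ z ∈ nbr2 0, ((z μ : ℤ) : ℝ) * ((z ν : ℤ) : ℝ) * hhat z * freeKer (a + b) (u + z) := by
    rw [Finset.mul_sum, Finset.mul_sum, Finset.mul_sum, ← Finset.sum_add_distrib]
    refine Finset.sum_congr rfl fun z _ => ?_
    simp only [Pi.add_apply, Int.cast_add]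
    ring
  rw [hS]
  have hne : a + b ≠ 0 := hab.ne'
  field_simp
  linear_combination (-(b * a * ((u μ : ℤ) : ℝ))) * hi

include hibp in
/-- Second-order collapse with the squared wedge weight:
`Σ_w k_a(w) (v∧w)² k_b(w − u) = α² (v∧u)² k_{a+b}(u) − bα Σ_z ĥ(z) (v∧z)² k_{a+b}(u+z)`, `α = a/(a+b)`. -/
theorem hasSum_ker_wedge_sq_ker {a b : ℝ} (ha : 0 ≤ a) (hb : 0 ≤ b) (hab : 0 < a + b) (v u : Site 4) :
    HasSum (fun w : Site 4 => freeKer a w * (((wedge v w : ℤ) : ℝ) ^ 2 * freeKer b (w - u)))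
      ((a / (a + b)) ^ 2 * ((wedge v u : ℤ) : ℝ) ^ 2 * freeKer (a + b) u -
        b * (a / (a + b)) * ∑ z ∈ nbr2 0, hhat z * ((wedge v z : ℤ) : ℝ) ^ 2 * freeKer (a + b) (u + z)) := by
  have h11 := (hasSum_ker_coord_coord_ker hsemi hibp heven ha hb hab u 1 1).mul_left (((v 0 : ℤ) : ℝ) ^ 2)
  have h00 := (hasSum_ker_coord_coord_ker hsemi hibp heven ha hb hab u 0 0).mul_left (((v 1 : ℤ) : ℝ) ^ 2)
  have h01 := (hasSum_ker_coord_coord_ker hsemi hibp heven ha hb hab u 0 1).mul_left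
    (2 * ((v 0 : ℤ) : ℝ) * ((v 1 : ℤ) : ℝ))
  refine hasSum_of_eq ((h11.add h00).sub h01) (fun w => ?_) ?_
  · simp only [wedge]; push_cast; ring
  · have hsum : ∀ F : Site 4 → ℝ,
        ((v 0 : ℤ) : ℝ) ^ 2 * ∑ z ∈ nbr2 0, ((z 1 : ℤ) : ℝ) * ((z 1 : ℤ) : ℝ) * hhat z * F z +
          ((v 1 : ℤ) : ℝ) ^ 2 * ∑ z ∈ nbr2 0, ((z 0 : ℤ) : ℝ) * ((z 0 : ℤ) : ℝ) * hhat z * F z -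
          2 * ((v 0 : ℤ) : ℝ) * ((v 1 : ℤ) : ℝ) * ∑ z ∈ nbr2 0, ((z 0 : ℤ) : ℝ) * ((z 1 : ℤ) : ℝ) * hhat z * F z =
        ∑ z ∈ nbr2 0, hhat z * ((wedge v z : ℤ) : ℝ) ^ 2 * F z := by
      intro F
      rw [Finset.mul_sum, Finset.mul_sum, Finset.mul_sum, ← Finset.sum_add_distrib, ← Finset.sum_sub_distrib]
      refine Finset.sum_congr rfl fun z _ => ?_
      simp only [wedge]; push_cast; ring
    have hW : ((wedge v u : ℤ) : ℝ) = ((v 0 : ℤ) : ℝ) * ((u 1 : ℤ) : ℝ) - ((v 1 : ℤ) : ℝ) * ((u 0 : ℤ) : ℝ) := by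
      simp only [wedge]; push_cast; ring
    rw [hW]
    linear_combination (-(b * (a / (a + b)))) * hsum (fun z => freeKer (a + b) (u + z))

end Collapse


/-! ## Registered headline -/

/-- Registered headline of this helper file (aux stub `stub_secondOrderCoefficientAuxC` of crux
stmt-QuantumFields-16786, line `Sketch`): the first-order single-momentum collapse. -/
theorem stub_secondOrderCoefficientAuxC :
    ∀ (hsemi : ∀ s r : ℝ, 0 ≤ s → 0 ≤ r → ∀ w : Site 4,
        HasSum (fun y : Site 4 => freeKer s y * freeKer r (w - y)) (freeKer (s + r) w))
      (hibp : ∀ t : ℝ, 0 ≤ t → ∀ (w : Site 4) (ν : Fin 4),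
        t * (∑ z ∈ nbr2 0, ((z ν : ℤ) : ℝ) * hhat z * freeKer t (w - z)) + ((w ν : ℤ) : ℝ) * freeKer t w = 0)
      (heven : ∀ (t : ℝ) (w : Site 4), freeKer t (-w) = freeKer t w)
      (a b : ℝ), 0 ≤ a → 0 ≤ b → 0 < a + b → ∀ (u : Site 4) (ν : Fin 4),
      HasSum (fun w : Site 4 => freeKer a w * (((w ν : ℤ) : ℝ) * freeKer b (w - u)))
        (a / (a + b) * ((u ν : ℤ) : ℝ) * freeKer (a + b) u) :=
  fun hsemi hibp heven _ _ ha hb hab u ν => hasSum_ker_coord_ker hsemi hibp heven ha hb hab u ν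

end Summit.QuantumFields.QCD.Cruxes.QuarkLoopCoefficient.Sketch.SecondOrderCoefficient

end
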